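import Literature.NumberTheory.LFunctions.Zhang2022.RepairGapLemma58Premise
import Literature.NumberTheory.LFunctions.Zhang2022.Section12U030ResidueTwo
import HarnessLib

/-!
# Zhang (2022), rescue GAP/BED (D-0124 (3)(4)): §12 p. 70 — the exceptional-zero residue of the `Ξ₁₂` contour evaluation
# against its model under the minimum premise `‖L(1,χ)‖ ≤ 𝓛⁻¹⁵` (GAP G-31 «(A)-exponent E: main terms only E ≥ 15»)

Topic `Literature/NumberTheory/LFunctions/Zhang2022` (Landau–Siegel audit tree; verdict-neutral).
Y. Zhang, *Discrete mean estimates and the Landau–Siegel zero*, arXiv:2211.02515v1 (2022)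
[Zhang2022LandauSiegel] — **an unrefereed manuscript under adjudication; nothing in this file asserts or
denies its Theorems 1–2, and nothing here is a claim about Landau–Siegel zeros. The programme SEARCHES and
TYPES; no claim about Landau–Siegel zeros, Theorems 1–2 of arXiv:2211.02515 or a repaired Margin232 until a
kernel theorem says so.**

§12 p. 70 (proof of Lemma 12.3): the second residue of the smoothed-sum contour evaluation behind `Ξ₁₂` — the one at
the pole coming from the exceptional zero `ρ̃` of `L(s,χ)`, `r·K(τ)` with `r = 𝒰(ρ̃)L(ρ̃+β_a)L(ρ̃+β_b)/L′(ρ̃,χ)` — compared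
with the model `L′(1,χ)Π(d,r)β_aβ_b·Y^{−s}/(−s)`: the tree's `Lemma84.norm_resTwo_sub_model_le` (explicit hypothesis
`‖L(1,χ)‖ ≤ 𝓛⁻²⁰²²`, used once — Lemma 5.8 at the two shifted `L`-values). This file proves the same estimate, SAME
CONSTANTS, from `‖L(1,χ)‖ ≤ 𝓛⁻¹⁵` (`Repair.Gap.lemma58_of_norm_le_pow15`, p561913), completing the §12 pair with
`Lemma84.norm_resOne_sub_model_le_pow15` (`RepairGapSection12ResiduePremise`, p587696). The size inputs on `1 − ρ̃`
(`hρα`, `hρL`, `hρE`, `hρY`) are hypotheses here exactly as in the tree — where the manuscript takes them from (A)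
(`1 − ρ̃ ≪ 𝓛⁻²⁰²²`, Lemma 5.5) is a different door (the exceptional-zero / Deuring–Heilbronn input), not Lemma 5.8's.
Proof = the tree's verbatim with the one Lemma 5.8 call re-pointed. Theorems only; no definition, no named fact.

## References

* Y. Zhang, arXiv:2211.02515v1 (2022), §12 p. 70 (proof of Lemma 12.3); §8 proof of Lemma 8.4 p. 47; §5 Lemma 5.8.
  [cite: Zhang2022LandauSiegel, §12 p. 70; §8 Lemma 8.4; §5 Lemma 5.8]
-/

noncomputable section

open Complex Real

namespace Literature.NumberTheory.LFunctions.Zhang2022.Lemma84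

open Literature.NumberTheory.LFunctions.Zhang2022.Skeleton
open Literature.NumberTheory.LFunctions.Zhang2022.GaussWeight

variable {D : ℕ} [NeZero D] (χ : DirichletCharacter ℂ D) (c' : ℝ)

set_option maxHeartbeats 1000000 in
/-- **The exceptional-zero residue against the model under the minimum premise** (twin of
`Lemma84.norm_resTwo_sub_model_le`, same bound): all hypotheses as there (`K ≥ 7+15|c′|`, `Kπ ≤ 𝓛⁸`,
`0 < ℓ₀ ≤ |L′(1,χ)|`, `E ≤ ℓ₀α/4`, Lemma 8.3 (iii′) relative form, the `1 − ρ̃` sizes, `1 ≤ Y`, `α log Y ≤ π`, `1 ≤ Λ`,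
`|w| = α`) except that `‖L(1,χ)‖ ≤ 𝓛⁻²⁰²²` is replaced by `‖L(1,χ)‖ ≤ 𝓛⁻¹⁵` — the only use of that premise in this step is
Lemma 5.8 at `ρ̃ + β_a`, `ρ̃ + β_b`. [cite: Zhang2022LandauSiegel, §12 p. 70 (proof of Lemma 12.3); §8 Lemma 8.4 (proof)] -/
theorem norm_resTwo_sub_model_le_pow15 (hprim : χ.IsPrimitive) (h𝓛 : 3 ≤ Real.log D)
    (h15 : ‖χ.LFunction 1‖ ≤ 1 / Real.log D ^ 15) (j : ℕ) {d r : ℕ} (hd : d ≠ 0) (hr : r ≠ 0)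
    (U : ℂ → ℂ) {C₈₃ K ℓ₀ : ℝ} (hC₈₃ : 0 ≤ C₈₃) (hK : 7 + 15 * |c'| ≤ K)
    (hKL : K * π ≤ Real.log D ^ 8) (hℓ₀ : 0 < ℓ₀) (hℓ : ℓ₀ ≤ ‖deriv χ.LFunction 1‖)
    (hE : (1 + 16 * Real.exp (9 / 2) * π ^ 2 * K ^ 2) / Real.log D ^ 15 ≤ ℓ₀ * alpha D / 4)
    (hU3 : ∀ s : ℂ, ‖s - 1‖ ≤ 5 * alpha D → ‖U s - PiW χ d r‖ ≤
      C₈₃ * (ell D ^ 8)⁻¹ * ∏ q ∈ (d * r).primeFactors, (1 - (q : ℝ)⁻¹)⁻¹)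
    {ρ : ℝ} (hρ1 : ρ ≤ 1) (hρα : 1 - ρ ≤ alpha D / 4) (hρL : 1 - ρ ≤ 1 / (4 * Real.log D))
    (hρE : 8 * Real.exp (9 / 2) * (1 + Real.log D) * Real.log D ^ 2 * (1 - ρ) ≤ ℓ₀ / 2)
    {Y Λ : ℝ} (hY : 1 ≤ Y) (hαY : alpha D * Real.log Y ≤ π) (hρY : (1 - ρ) * Real.log Y ≤ 1)
    (hΛ : 1 ≤ Λ) {w : ℂ} (hw : ‖w‖ = alpha D) :
    ‖U ρ * χ.LFunction (ρ + betaJ c' D (j + 1)) * χ.LFunction (ρ + betaJ c' D (j + 2)) /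
          deriv χ.LFunction ρ *
          ((Y : ℂ) ^ (((ρ - 1 : ℝ) : ℂ) - (w - beta6 D)) *
            omega1 Λ (((ρ - 1 : ℝ) : ℂ) - (w - beta6 D)) / (((ρ - 1 : ℝ) : ℂ) - (w - beta6 D))) -
        deriv χ.LFunction 1 * PiW χ d r *
          (betaJ c' D (j + 1) * betaJ c' D (j + 2) *
            ((Y : ℂ) ^ (-(w - beta6 D)) / (-(w - beta6 D))))‖ ≤
      8 * Real.exp π / alpha D *
          (8 * (C₈₃ * (ell D ^ 8)⁻¹ * ∏ q ∈ (d * r).primeFactors, (1 - (q : ℝ)⁻¹)⁻¹) *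
              (2 * Real.exp (9 / 2) * (1 + Real.log D) * Real.log D) * K ^ 2 * alpha D ^ 2 +
            6 * (∏ q ∈ (d * r).primeFactors, (1 - (q : ℝ)⁻¹)⁻¹) ^ 2 * K * alpha D *
              ((1 + 16 * Real.exp (9 / 2) * π ^ 2 * K ^ 2) / Real.log D ^ 15) +
            2 * (∏ q ∈ (d * r).primeFactors, (1 - (q : ℝ)⁻¹)⁻¹) ^ 2 * K ^ 2 * alpha D ^ 2 *
              (8 * Real.exp (9 / 2) * (1 + Real.log D) * Real.log D ^ 2 * (1 - ρ)) +
            4 * (∏ q ∈ (d * r).primeFactors, (1 - (q : ℝ)⁻¹)⁻¹) ^ 2 *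
              (2 * Real.exp (9 / 2) * (1 + Real.log D) * Real.log D) * K * alpha D * (1 - ρ)) +
        (∏ q ∈ (d * r).primeFactors, (1 - (q : ℝ)⁻¹)⁻¹) ^ 2 *
            (2 * Real.exp (9 / 2) * (1 + Real.log D) * Real.log D) * K ^ 2 * alpha D ^ 2 *
          (Real.exp π * ((2 * Real.exp 1 * |ρ - 1| * Real.log Y + 1 / (2 * Λ)) * (4 / alpha D) +
            |ρ - 1| * (8 / alpha D ^ 2))) := by
  set 𝓛 : ℝ := Real.log D with h𝓛def
  set α : ℝ := alpha D with hαdef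
  set βa : ℂ := betaJ c' D (j + 1) with hβadef
  set βb : ℂ := betaJ c' D (j + 2) with hβbdef
  set hatPi : ℝ := ∏ q ∈ (d * r).primeFactors, (1 - (q : ℝ)⁻¹)⁻¹ with hhatPi
  set E : ℝ := (1 + 16 * Real.exp (9 / 2) * π ^ 2 * K ^ 2) / 𝓛 ^ 15 with hEdef
  set E' : ℝ := 8 * Real.exp (9 / 2) * (1 + 𝓛) * 𝓛 ^ 2 * (1 - ρ) with hE'def
  set ℓ : ℂ := deriv χ.LFunction 1 with hℓdef
  set ℓ₁ : ℝ := 2 * Real.exp (9 / 2) * (1 + 𝓛) * 𝓛 with hℓ₁def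
  have hℓ2 : 2 ≤ ell D := by rw [ell]; linarith
  have h𝓛0 : 0 < 𝓛 := by linarith
  have hα0 : 0 < α := alpha_pos' (by linarith)
  have hαeq : α = π / 𝓛 ^ 9 := alpha_eq D
  have hαℓ : α * ell D ≤ 1 := alpha_mul_ell_le_one hℓ2
  have hα5 : α ≤ 1 / 5 := by
    rw [hαeq, div_le_iff₀ (by positivity)]
    have h9 : (3 : ℝ) ^ 9 ≤ 𝓛 ^ 9 := pow_le_pow_left₀ (by norm_num) h𝓛 9
    nlinarith [Real.pi_le_four]
  have hK1 : 1 ≤ K := by linarith [abs_nonneg c']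
  have hκ0 : ρ - 1 ≤ 0 := by linarith
  have hκ : -(α / 4) ≤ ρ - 1 := by rw [hαdef]; linarith
  have habsκ : |ρ - 1| = 1 - ρ := by rw [abs_of_nonpos hκ0]; ring
  -- the variable `s = w − β₆`
  set s : ℂ := w - beta6 D with hsdef
  obtain ⟨hs_lo, hs_hi⟩ := norm_w_sub_beta6_bounds h𝓛 hw
  rw [← hsdef, ← hαdef] at hs_lo hs_hi
  have hs1 : ‖s‖ ≤ 1 / 2 := by linarith
  have hsre : -α ≤ s.re := by
    have h1 : s.re = w.re := by simp [hsdef, beta6]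
    rw [h1]
    have h2 : |w.re| ≤ ‖w‖ := Complex.abs_re_le_norm w
    rw [hw] at h2
    linarith [neg_abs_le w.re]
  -- sizes of the shifts
  have hβ : ∀ i : ℕ, ‖betaJ c' D i‖ ≤ 3 * α * (1 + 5 * |c'|) := by
    intro i
    have h := norm_betaJ_le c' D i hα0.le (by linarith : 0 ≤ ell D)
    refine h.trans ?_
    have : 5 * |c'| * alpha D * ell D ≤ 5 * |c'| := by
      calc 5 * |c'| * alpha D * ell D = 5 * |c'| * (alpha D * ell D) := by ring
        _ ≤ 5 * |c'| * 1 := by gcongr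
        _ = 5 * |c'| := mul_one _
    rw [← hαdef] at this ⊢
    nlinarith [abs_nonneg c']
  have haK : ‖βa‖ ≤ K * α := by
    calc ‖βa‖ ≤ 3 * α * (1 + 5 * |c'|) := hβ _
      _ ≤ K * α := by nlinarith [abs_nonneg c']
  have hbK : ‖βb‖ ≤ K * α := by
    calc ‖βb‖ ≤ 3 * α * (1 + 5 * |c'|) := hβ _
      _ ≤ K * α := by nlinarith [abs_nonneg c']
  -- `A = (ρ̃ − 1) + β_a`, `B = (ρ̃ − 1) + β_b`
  set A : ℂ := ((ρ - 1 : ℝ) : ℂ) + βa with hAdef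
  set B : ℂ := ((ρ - 1 : ℝ) : ℂ) + βb with hBdef
  have hκn : ‖((ρ - 1 : ℝ) : ℂ)‖ = 1 - ρ := by
    rw [Complex.norm_real, Real.norm_eq_abs, habsκ]
  have hAK : ‖A‖ ≤ K * α := by
    calc ‖A‖ ≤ ‖((ρ - 1 : ℝ) : ℂ)‖ + ‖βa‖ := norm_add_le _ _
      _ ≤ α / 4 + 3 * α * (1 + 5 * |c'|) := by rw [hκn]; exact add_le_add (by linarith) (hβ _)
      _ ≤ K * α := by nlinarith [abs_nonneg c']
  have hBK : ‖B‖ ≤ K * α := by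
    calc ‖B‖ ≤ ‖((ρ - 1 : ℝ) : ℂ)‖ + ‖βb‖ := norm_add_le _ _
      _ ≤ α / 4 + 3 * α * (1 + 5 * |c'|) := by rw [hκn]; exact add_le_add (by linarith) (hβ _)
      _ ≤ K * α := by nlinarith [abs_nonneg c']
  have hAa : ‖A - βa‖ ≤ 1 - ρ := by rw [hAdef, add_sub_cancel_right, hκn]
  have hBb : ‖B - βb‖ ≤ 1 - ρ := by rw [hBdef, add_sub_cancel_right, hκn]
  -- Lemma 5.8 at `1 + A`, `1 + B`
  have h58 : ∀ z : ℂ, ‖z‖ ≤ K * α → ‖χ.LFunction (1 + z) - ℓ * z‖ ≤ E := by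
    intro z hz
    have hz' : ‖(1 + z) - 1‖ ≤ K * π / Real.log D ^ 9 := by
      rw [add_sub_cancel_left, ← h𝓛def]
      calc ‖z‖ ≤ K * α := hz
        _ = K * π / 𝓛 ^ 9 := by rw [hαeq]; ring
    have h := Repair.Gap.lemma58_of_norm_le_pow15 χ hprim h𝓛 h15 hKL hz'
    rw [add_sub_cancel_left] at h
    exact h
  have hρA : (ρ : ℂ) + βa = 1 + A := by rw [hAdef]; push_cast; ring
  have hρB : (ρ : ℂ) + βb = 1 + B := by rw [hBdef]; push_cast; ring
  have ha : ‖χ.LFunction ((ρ : ℂ) + βa) - ℓ * A‖ ≤ E := by rw [hρA]; exact h58 _ hAK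
  have hb : ‖χ.LFunction ((ρ : ℂ) + βb) - ℓ * B‖ ≤ E := by rw [hρB]; exact h58 _ hBK
  -- `L′(ρ̃) − L′(1)`
  have h0 : ‖deriv χ.LFunction ρ - ℓ‖ ≤ E' := by
    have hβ' : ‖(((1 - ρ : ℝ)) : ℂ)‖ ≤ 1 / (4 * Real.log D) := by
      rw [Complex.norm_real, Real.norm_eq_abs, abs_of_nonneg (by linarith)]; exact hρL
    have h := U055.norm_deriv_LFunction_sub_le χ h𝓛 hprim hβ'
    have e : (1 : ℂ) - (((1 - ρ : ℝ)) : ℂ) = (ρ : ℂ) := by push_cast; ring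
    rw [e, Complex.norm_real, Real.norm_eq_abs, abs_of_nonneg (by linarith : (0 : ℝ) ≤ 1 - ρ)] at h
    rw [hE'def]
    exact h
  -- Lemma 8.3 (iii′) at `ρ̃`
  have hu : ‖U ρ - PiW χ d r‖ ≤ C₈₃ * (ell D ^ 8)⁻¹ * hatPi :=
    hU3 _ (by
      have : (ρ : ℂ) - 1 = ((ρ - 1 : ℝ) : ℂ) := by push_cast; ring
      rw [this, hκn]; linarith)
  have hE0 : 0 ≤ E := by positivity
  have hhat0 : 0 ≤ hatPi := Finset.prod_nonneg fun q hq => by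
    have hq2 : (2 : ℝ) ≤ q := by exact_mod_cast (Nat.prime_of_mem_primeFactors hq).two_le
    have : (q : ℝ)⁻¹ ≤ 1 / 2 := by rw [inv_eq_one_div]; gcongr
    exact inv_nonneg.2 (by linarith)
  have hEU0 : 0 ≤ C₈₃ * (ell D ^ 8)⁻¹ * hatPi := by positivity
  have hE'0 : 0 ≤ E' := by
    rw [hE'def]
    have h1 : 0 ≤ 1 - ρ := by linarith
    have h2 : 0 ≤ 8 * Real.exp (9 / 2) * (1 + 𝓛) * 𝓛 ^ 2 := by positivity
    exact mul_nonneg h2 h1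
  have hE'ℓ : E' ≤ ℓ₀ / 2 := hρE
  -- the coefficient algebra
  have hcoef := norm_coeff_sub_model_le (u := U ρ) (La := χ.LFunction ((ρ : ℂ) + βa))
    (Lb := χ.LFunction ((ρ : ℂ) + βb)) (L0 := deriv χ.LFunction ρ) (Pv := PiW χ d r) (ℓ := ℓ)
    (A := A) (B := B) (a := βa) (b := βb) hα0 hK1 hℓ₀ hℓ hE0 hEU0 hE'0 (by linarith) hE hE'ℓ
    ha hb h0 hu hAK hBK haK hbK hAa hBb
  -- the kernel
  have hker := norm_kernel_le (Y := Y) (Λ := Λ) (s := s) hα0 hκ0 hκ hs_lo hs1 hsre hY hαY hΛ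
  have hkerd := norm_kernel_sub_le (Y := Y) (Λ := Λ) (s := s) hα0 hκ0 hκ hs_lo hs1 hsre hY hαY
    (by rw [habsκ]; exact hρY) hΛ
  have eκ : (((ρ - 1 : ℝ)) : ℂ) = ((ρ - 1 : ℝ) : ℂ) := rfl
  -- combine: `rK − Πℓab·K₀ = (r − Πℓab)K + Πℓab(K − K₀)`
  set Kτ : ℂ := (Y : ℂ) ^ (((ρ - 1 : ℝ) : ℂ) - s) * omega1 Λ (((ρ - 1 : ℝ) : ℂ) - s) /
    (((ρ - 1 : ℝ) : ℂ) - s) with hKτ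
  set K₀ : ℂ := (Y : ℂ) ^ (-s) / (-s) with hK₀
  set rr : ℂ := U ρ * χ.LFunction ((ρ : ℂ) + βa) * χ.LFunction ((ρ : ℂ) + βb) /
    deriv χ.LFunction ρ with hrr
  have hsplit : rr * Kτ - ℓ * PiW χ d r * (βa * βb * K₀) =
      (rr - PiW χ d r * ℓ * βa * βb) * Kτ + PiW χ d r * ℓ * βa * βb * (Kτ - K₀) := by ring
  rw [hsplit]
  have hPi : ‖PiW χ d r‖ ≤ hatPi ^ 2 := norm_PiW_le_prodInv χ hd hr
  have hℓle : ‖ℓ‖ ≤ ℓ₁ :=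
    Lemma31.norm_deriv_LFunction_le_near_one χ h𝓛 hprim (w := 1)
      (by rw [sub_self, norm_zero]; positivity)
  have h1 : ‖(rr - PiW χ d r * ℓ * βa * βb) * Kτ‖ ≤
      (8 * (C₈₃ * (ell D ^ 8)⁻¹ * hatPi) * ℓ₁ * K ^ 2 * α ^ 2 + 6 * hatPi ^ 2 * K * α * E +
        2 * hatPi ^ 2 * K ^ 2 * α ^ 2 * E' + 4 * hatPi ^ 2 * ℓ₁ * K * α * (1 - ρ)) *
        (8 * Real.exp π / α) := by
    rw [norm_mul]
    refine mul_le_mul (hcoef.trans ?_) hker (norm_nonneg _) (by positivity)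
    have : 0 ≤ 1 - ρ := by linarith
    gcongr
  have h2 : ‖PiW χ d r * ℓ * βa * βb * (Kτ - K₀)‖ ≤
      hatPi ^ 2 * ℓ₁ * (K * α) * (K * α) *
        (Real.exp π * ((2 * Real.exp 1 * |ρ - 1| * Real.log Y + 1 / (2 * Λ)) * (4 / α) +
          |ρ - 1| * (8 / α ^ 2))) := by
    rw [norm_mul, norm_mul, norm_mul, norm_mul]
    gcongr
  calc ‖(rr - PiW χ d r * ℓ * βa * βb) * Kτ + PiW χ d r * ℓ * βa * βb * (Kτ - K₀)‖
      ≤ ‖(rr - PiW χ d r * ℓ * βa * βb) * Kτ‖ + ‖PiW χ d r * ℓ * βa * βb * (Kτ - K₀)‖ :=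
        norm_add_le _ _
    _ ≤ _ := add_le_add h1 h2
    _ = _ := by ring

end Literature.NumberTheory.LFunctions.Zhang2022.Lemma84
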